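import Mathlib.Algebra.MvPolynomial.Equiv
import Mathlib.Algebra.Polynomial.Roots

/-!
# `PairwiseCurvedTilingsLC` (crux stmt-MatrixMultiplication-17883), line LonelyTranslates (c1):
a non-zero polynomial in one variable has finitely many zeros (helper H6)

Pure commutative algebra, used in Case 1 of the chart induction (`stub_openPiece`): an infinite
subset of a coordinate line minus the zero set of a non-zero one-variable polynomial is still
infinite.  We transport `P : MvPolynomial (Fin 1) K` to the univariate polynomial
`MvPolynomial.uniqueAlgEquiv K (Fin 1) P`, whose evaluation at `v 0` is `MvPolynomial.eval v P`
(`eval_uniqueAlgEquiv_fin_one`), and whose zero set is contained in the finite multiset of its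
roots.  [folklore]
-/

set_option linter.dupNamespace false  -- `Summit.<S>.<S>.…` is the mandated namespace

namespace Summit.MatrixMultiplication.MatrixMultiplication.Theorems.PairwiseCurvedTilingsLC.Negative

/-- Evaluating the univariate polynomial attached to `P : MvPolynomial (Fin 1) K` at `v 0` is
evaluating `P` at `v`.  [folklore] -/
theorem eval_uniqueAlgEquiv_fin_one {K : Type} [CommSemiring K] (P : MvPolynomial (Fin 1) K)
    (v : Fin 1 → K) :
    Polynomial.eval (v 0) (MvPolynomial.uniqueAlgEquiv K (Fin 1) P) = MvPolynomial.eval v P := by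
  rw [← Polynomial.eval₂_id, ← MvPolynomial.eval₂_id, ← Fin.default_eq_zero,
    MvPolynomial.eval₂_uniqueAlgEquiv]

/-- The zeros `v : Fin 1 → K` of `P : MvPolynomial (Fin 1) K` are exactly the points whose unique
coordinate is a root of the attached univariate polynomial.  [folklore] -/
theorem eval_eq_zero_iff_isRoot_uniqueAlgEquiv {K : Type} [CommSemiring K]
    (P : MvPolynomial (Fin 1) K) (v : Fin 1 → K) :
    MvPolynomial.eval v P = 0 ↔ (MvPolynomial.uniqueAlgEquiv K (Fin 1) P).IsRoot (v 0) := by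
  rw [Polynomial.IsRoot.def, eval_uniqueAlgEquiv_fin_one]

/-- **A non-zero polynomial in one variable has finitely many zeros** (helper H6 of line
LonelyTranslates, c1): for `P : MvPolynomial (Fin 1) K`, `P ≠ 0`, over a field `K`, the zero set
`{v : Fin 1 → K | eval v P = 0}` is finite — it injects, via `v ↦ v 0`, into the roots of the
univariate polynomial `MvPolynomial.uniqueAlgEquiv K (Fin 1) P ≠ 0`.  [folklore] -/
theorem stub_finite_zeros_fin_one {K : Type} [Field K] (P : MvPolynomial (Fin 1) K) (hP : P ≠ 0) :
    {v : Fin 1 → K | MvPolynomial.eval v P = 0}.Finite := by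
  classical
  have hp0 : MvPolynomial.uniqueAlgEquiv K (Fin 1) P ≠ 0 :=
    (map_ne_zero_iff _ (MvPolynomial.uniqueAlgEquiv K (Fin 1)).injective).2 hP
  have hinj : Function.Injective fun v : Fin 1 → K => v 0 := fun x y h =>
    funext fun i => by rw [Fin.fin_one_eq_zero i]; exact h
  refine ((MvPolynomial.uniqueAlgEquiv K (Fin 1) P).roots.toFinset.finite_toSet.preimage
    hinj.injOn).subset fun v hv => ?_
  rw [Set.mem_preimage, Finset.mem_coe, Multiset.mem_toFinset, Polynomial.mem_roots hp0,
    ← eval_eq_zero_iff_isRoot_uniqueAlgEquiv]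
  exact hv

end Summit.MatrixMultiplication.MatrixMultiplication.Theorems.PairwiseCurvedTilingsLC.Negative
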